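import Literature.MathematicalPhysics.QuantumFieldTheory.Balaban1983to89.Node00.OpsYLocalInverse
import Literature.MathematicalPhysics.QuantumFieldTheory.Balaban1983to89.Node00.OpsYDeltaA

/-!
# `Balaban1983to89.Node00.OpsYDeltaALocal` — print's LOCAL gauge projection `R_□(U) = I − G′_□Q′*C_□Q′G′_□`, the LOCALISED operator
# `Δ_{a,□}(U) = Δ(U) + D R_□(U) D* + Q*aQ` of (3.105) p. 414 and its local inverse `G_□(U)`, AT def-Y's LETTERS and W-a's local cube inverse
# `G′_□(U) = GsqY` — projection-parametric (W-a, file A-2; definitions with bodies + the ring algebra of padded compressions; NO estimate)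

FRAMING (verbatim cell line):
statement-level skeleton of published theorems with citation tags; proofs where landed; nothing here is a claim about the Yang–Mills mass gap

Sources: T. Bałaban, *Propagators for lattice gauge theories in a background field*, Commun. Math. Phys. **99** (1985) 389–434
[`Balaban1985BackgroundPropagators`, "B9"]: (3.25)–(3.27) pp. 394–395 («R(U) = I − G′Q′*(Q′G′²Q′*)⁻¹Q′G′ … Δ_a(U) = Δ(U) + D_U R(U) D*_U +
Q*(U)aQ(U) … G(U) = Δ_a(U)⁻¹»), Sect. C pp. 408–409 («for the sequence {Ω_n(□)} … G′_□(U), C_□(U) = (Q′(U)G′_□²(U)Q′*(U))⁻¹, G_□(U)»), (3.87) p. 409,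
(3.95)–(3.96) p. 411 (`C₀ = Σ_□ h_□C_□h_□`), (3.104)–(3.106) p. 414: «Δ_aG₀ = I − Σ_□K(h_□)G_□h_□ − Σ_□(1−ζ_□)DPD*h_□G_□h_□ − Σ_□ζ_□(DPD* − DP_□D*)h_□G_□h_□
− Σ_□ζ_□P_□(∂h_□)G_□h_□ = I − R» — whose third sum carries exactly the DEFECT `D(P − P_□)D*` between the global and the local gauge projection;
T. Bałaban, *Propagators and renormalization transformations for lattice gauge theories. II*, Commun. Math. Phys. **96** (1984) 223–250
[`Balaban1984PropagatorsII`], (2.17)–(2.20) pp. 225–226 (the operators Q, Q′, a), (2.69) p. 235.  Unit `pub-ymgap-node00-def-Y` (def-Y gen 21).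

## WHAT IS PRINTED (verbatim up to notation)
p. 409 l. 1–5: «The operators constructed for this sequence, which we denote by G′_□(U), C_□(U) = (Q′(U)G′_□²(U)Q′*(U))⁻¹, G_□(U), satisfy all the
inequalities of Theorems 3.1–3.3»; (3.105) p. 414 displays `Δ_aG₀` with the terms `DPD*h_□G_□h_□` and `DP_□D*h_□G_□h_□`, `P = G′Q′*CQ′G′` (p. 415 l. 1:
«P = G′Q′*(Q′G′²Q′*)⁻¹Q′G′»), `P_□` its local version built from `G′_□`, `C_□`.

## WHAT THIS FILE PROVIDES (def-Y's conventions M1–M5 of `OpsYDeltaA`; lattice units; every definition has a body)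
The letters are PROJECTION-PARAMETRIC: `P : End_ℂ(BlkY i → 𝔸)` is the cut to the cube's BLOCKS (a consumer takes `P := cutMulY 𝟙_{Dblk}`, e.g.
`B9Thm39CubeOpsAtLettersY`'s `cutMulY (blkIndY i Dblk)`), `PB : End_ℂ(FBondY i → 𝔸)` the cut to the cube's BONDS; `D : Finset (SiteY i)` is the
site set □̃ of W-a's local site inverse `GsqY i parS D` (`OpsYLocalInverse`, file A-0).  With `X_□(U) := XY i parS (GsqY i parS D) U = Q′G′_□G′_□Q′*`:
* §1 `padXlocY := dirPadY P X_□(U)` (the padded compression `P X_□ P + (1 − P)`), ★ `ClocY := dirInvY P X_□(U)` = **C_□(U)** (the local inverse on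
  the range of `P`, `0` off it and `0` outside the unit locus), ★ `PlocY := G′_□ Q′* C_□ Q′ G′_□` = **P_□(U)**, ★ `RlocY := id − PlocY` = **R_□(U)**,
  ★★ `deltaALocY := hessY U + gradY U ∘ R_□(U) ∘ divY U + Q*aQ` = **Δ_{a,□}(U)** (the SAME formula as `deltaAY` (3.26) with `R ↦ R_□`),
  `padDeltaALocY := dirPadY PB Δ_{a,□}(U)`, ★★ `GAsqY := fun U ↦ dirInvY PB Δ_{a,□}(U)` = **G_□(U)** (a `BondOpY`: the padded-compression inverse,
  the same convention as the site letter `GsqY`).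
* §2 the support ∕ complement ∕ unit-locus calculus of `C_□` and `G_□` from A-0's ring lemmas (`P C_□ = C_□ = C_□ P`, `(1 − P) C_□ = 0`,
  `P X_□ P · C_□ = P` and `C_□ · P X_□ P = P` where the padded compression is a unit; the bond-side twins for `G_□`), and ★ the LOCAL-INVERSE
  PROPERTY `M_h Δ_{a,□}(U) G_□(U) M_h = M_h²` for every real cut-off `h` absorbed by `PB` — the `h T_c G_c h = h²` input of the (3.105)-shaped
  local-family identities (`B9Thm311PosViaLocalFamilyY`), from invertibility of the padded compression ALONE.
* §3 ★ the DEFECT IDENTITY `Δ_{a,□}(U) − Δ_a(U)[G′] = gradY U ∘ (R_□(U) − R(U)[G′]) ∘ divY U` for ANY site letter `G′` (print's `D(P − P_□)D*` term of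
  (3.105), up to def-Y's sign conventions), with `R_□ − R = P[G′] − P_□`.
* §4 SANITY FACES: with the trivial block cut `P = 1` the local letters ARE def-Y's global formulas at `G′ := G′_□`: `ClocY = XinvY`, `RlocY = RY`,
  `deltaALocY = deltaAY i parS parB (GsqY i parS D)`, `GAsqY … 1 1 = GAY i parS parB (GsqY i parS D)`; and with `D = univ` moreover `G′_□ = G′ = GpY`
  (A-0 `GsqY_univ`), so `deltaALocY i parS parB univ 1 = deltaAY i parS parB (GpY i parS)` — the global `Δ_a(U)` of (3.26).
* Instantiating the cuts by indicator multiplications `P := cutMulY χ` (idempotent for 0∕1-valued `χ`; `M_h M_χ = M_h` when `χ = 1` on the support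
  of `h`) is `B9Thm311PosViaLocalInversesY.cutMulY_mul_self_of_zero_one ∕ cutMulY_mul_cutMulY_of_support` — cited, not restated.

## HONEST SCOPE
* Definitions and ring identities only.  Invertibility of `padXlocY` (Thm 3.2's ∕ Thm 3.11's content; at `parSymY` and `G ≤ U(N)`-valued `U` it is
  `B9Thm39CubeOpsAtLettersY.isUnit_padX_parSymY`, not restated here) and of `padDeltaALocY` (Thm 3.3 ∕ Cor. 3.6 content) enter ONLY as hypotheses.
  Nothing of [B9] Thm 3.3, 3.10, 3.11, Cor. 3.6, (3.105)'s smallness or (3.106) is asserted.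
* SIBLING READING, NOT RESTATED: `B9CubeLettersBondOpsL0` (lit-balaban r05) types print's letters for the CUBE SEQUENCE itself (`G′_□ := GpCubeY`, the
  sequence's own variational propagator; `C_□` on the sequence's blocks `BlkCubeY i q`; `G_□ := Ring.inverse Δ_{a,□}`).  The present file is the
  COMPRESSION convention over W-a's `GsqY` (Dirichlet compression of `Δ′_a(U)` to □̃), the object the N06 rows 15–17 theorems and the walk instance
  are typed at; no identification between the two conventions is claimed.
* Nothing is inferred from the manuscript beyond the displayed formulas; kernel-checked.  NOT summit progress: N06 is not discharged by this file;
  no continuum limit, no OS axioms, no mass gap, no claim on the Clay problem.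
-/

namespace Literature.MathematicalPhysics.QuantumFieldTheory.Balaban1983to89.Node00.OpsYDeltaALocal

open B6KLevelCensusIndexV1 (KIdx)
open B9Thm37CubeCoverCommutators (cutMulY cutMulY_apply cutMulY_mul cutMulY_one)
open OpsYLocalInverse (dirPadY dirInvY GsqY dirInvY_congr dirInvY_of_not_isUnit mul_dirInvY dirInvY_mul compl_mul_dirInvY dirInvY_mul_compl
  compr_mul_dirInvY dirInvY_mul_compr P_mul_T_mul_dirInvY dirInvY_one_left GsqY_univ)

variable {𝔸 : Type} [NormedRing 𝔸] [NormedAlgebra ℂ 𝔸] [CompleteSpace 𝔸]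
variable {d ℓ : ℕ} {hd : 1 ≤ d + 1} {hL : Odd (ℓ + 1) ∧ 1 < ℓ + 1} {b₀ b₁ : ℝ}

/-! ## §1 The local letters `C_□(U)`, `P_□(U)`, `R_□(U)`, `Δ_{a,□}(U)`, `G_□(U)` -/

section Letters

variable (i : KIdx d ℓ hd hL b₀ b₁)

/-- the PADDED COMPRESSION `P X_□(U) P + (1 − P)` of `X_□(U) = Q′G′_□²Q′*(U)` to the cube's blocks — the operator whose invertibility is the regime
hypothesis of the local inverse `C_□(U)`. [cite: Balaban1985BackgroundPropagators, (3.87) p.409 (C_□ = (Q′G′_□²Q′*)⁻¹), pp.408–409] -/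
noncomputable def padXlocY (parS : SiteParY 𝔸 i) (D : Finset (SiteY i)) (P : Module.End ℂ (BlkY i → 𝔸)) (U : CfgY 𝔸 i) :
    Module.End ℂ (BlkY i → 𝔸) :=
  dirPadY P (XY i parS (GsqY i parS D) U)

/-- ★ **THE LOCAL INVERSE LETTER `C_□(U) = (Q′(U)G′_□²(U)Q′*(U))⁻¹`** on the cube's blocks: `P (P X_□ P + 1 − P)⁻¹ P` — the genuine inverse of the
compression on the range of `P` where the padded compression is a unit, `0` off the range and outside the unit locus.
[cite: Balaban1985BackgroundPropagators, pp.408–409 (C_□(U)), (3.87) p.409, (3.95)–(3.96) p.411] -/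
noncomputable def ClocY (parS : SiteParY 𝔸 i) (D : Finset (SiteY i)) (P : Module.End ℂ (BlkY i → 𝔸)) (U : CfgY 𝔸 i) :
    Module.End ℂ (BlkY i → 𝔸) :=
  dirInvY P (XY i parS (GsqY i parS D) U)

/-- ★ **THE LOCAL PROJECTION PART `P_□(U) = G′_□(U)Q′*(U)C_□(U)Q′(U)G′_□(U)`** (p. 415 l. 1 with the local letters).
[cite: Balaban1985BackgroundPropagators, (3.105) p.414 (P_□), p.415 (P = G′Q′*(Q′G′²Q′*)⁻¹Q′G′), (3.25) p.394] -/
noncomputable def PlocY (parS : SiteParY 𝔸 i) (D : Finset (SiteY i)) (P : Module.End ℂ (BlkY i → 𝔸)) (U : CfgY 𝔸 i) :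
    Module.End ℂ (SiteY i → 𝔸) :=
  GsqY i parS D U ∘ₗ QpsY i parS U ∘ₗ ClocY i parS D P U ∘ₗ QpY i parS U ∘ₗ GsqY i parS D U

/-- ★ **THE LOCAL GAUGE PROJECTION `R_□(U) = I − G′_□Q′*C_□Q′G′_□`** — (3.25) with the local letters.
[cite: Balaban1985BackgroundPropagators, (3.25) p.394, (3.105) p.414 (DP_□D*), pp.408–409] -/
noncomputable def RlocY (parS : SiteParY 𝔸 i) (D : Finset (SiteY i)) (P : Module.End ℂ (BlkY i → 𝔸)) (U : CfgY 𝔸 i) :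
    Module.End ℂ (SiteY i → 𝔸) :=
  LinearMap.id - PlocY i parS D P U

/-- ★★ **THE LOCALISED OPERATOR `Δ_{a,□}(U) = Δ(U) + D_U R_□(U) D*_U + Q*(U) a Q(U)`** on fine-bond functions — formula (3.26) with the local gauge
projection `R_□` (the operator of (3.105)–(3.106) inverted on the cube). [cite: Balaban1985BackgroundPropagators, (3.26) p.395, (3.105) p.414, pp.408–409 (G_□(U))] -/
noncomputable def deltaALocY (parS : SiteParY 𝔸 i) (parB : BondParY 𝔸 i) (D : Finset (SiteY i)) (P : Module.End ℂ (BlkY i → 𝔸))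
    (U : CfgY 𝔸 i) : Module.End ℂ (FBondY i → 𝔸) :=
  hessY i U + gradY i U ∘ₗ RlocY i parS D P U ∘ₗ divY i U + QsY i parB U ∘ₗ aY i ∘ₗ QY i parB U

/-- the PADDED COMPRESSION `PB Δ_{a,□}(U) PB + (1 − PB)` of `Δ_{a,□}(U)` to the cube's bonds — the operator whose invertibility is the regime
hypothesis of `G_□(U)`. [cite: Balaban1985BackgroundPropagators, pp.408–409 (G_□(U)), Thm 3.3 p.399] -/
noncomputable def padDeltaALocY (parS : SiteParY 𝔸 i) (parB : BondParY 𝔸 i) (D : Finset (SiteY i)) (P : Module.End ℂ (BlkY i → 𝔸))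
    (PB : Module.End ℂ (FBondY i → 𝔸)) (U : CfgY 𝔸 i) : Module.End ℂ (FBondY i → 𝔸) :=
  dirPadY PB (deltaALocY i parS parB D P U)

/-- ★★ **THE LOCAL BOND INVERSE `G_□(U)`**: the inverse of `Δ_{a,□}(U)` compressed to the bond functions in the range of `PB` (Dirichlet data
outside), extended by `0` — `PB (PB Δ_{a,□} PB + 1 − PB)⁻¹ PB`, the convention of the site letter `GsqY`.
[cite: Balaban1985BackgroundPropagators, pp.408–409 (G_□(U) for the sequence {Ω_n(□)}), (3.87) p.409 (G₀ = Σ h_□G_□h_□), (3.27) p.395] -/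
noncomputable def GAsqY (parS : SiteParY 𝔸 i) (parB : BondParY 𝔸 i) (D : Finset (SiteY i)) (P : Module.End ℂ (BlkY i → 𝔸))
    (PB : Module.End ℂ (FBondY i → 𝔸)) : BondOpY 𝔸 i :=
  fun U => dirInvY PB (deltaALocY i parS parB D P U)

/-! ## §2 Support, complement and unit-locus calculus -/

variable (parS : SiteParY 𝔸 i) (parB : BondParY 𝔸 i) (D : Finset (SiteY i))

/-- `C_□(U)` unfolded. [cite: Balaban1985BackgroundPropagators, pp.408–409 (C_□), bookkeeping] -/
theorem ClocY_def (P : Module.End ℂ (BlkY i → 𝔸)) (U : CfgY 𝔸 i) :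
    ClocY i parS D P U = P * Ring.inverse (padXlocY i parS D P U) * P := rfl

/-- `G_□(U)` unfolded. [cite: Balaban1985BackgroundPropagators, pp.408–409 (G_□), bookkeeping] -/
theorem GAsqY_def (P : Module.End ℂ (BlkY i → 𝔸)) (PB : Module.End ℂ (FBondY i → 𝔸)) (U : CfgY 𝔸 i) :
    GAsqY i parS parB D P PB U = PB * Ring.inverse (padDeltaALocY i parS parB D P PB U) * PB := rfl

/-- `C_□(U)` as A-0's local inverse of `X_□(U)` (definitional; the shape `dirInvY P T` of the local-family identities). [cite: Balaban1985BackgroundPropagators, pp.408–409 (C_□), bookkeeping] -/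
theorem ClocY_eq_dirInvY (P : Module.End ℂ (BlkY i → 𝔸)) (U : CfgY 𝔸 i) :
    ClocY i parS D P U = dirInvY P (XY i parS (GsqY i parS D) U) := rfl

/-- the padded compression of `Δ_{a,□}(U)`, definitional (the shape `dirPadY PB T` of the local-family positivity hypotheses).
[cite: Balaban1985BackgroundPropagators, pp.408–409 (G_□), bookkeeping] -/
theorem padDeltaALocY_eq_dirPadY (P : Module.End ℂ (BlkY i → 𝔸)) (PB : Module.End ℂ (FBondY i → 𝔸)) (U : CfgY 𝔸 i) :
    padDeltaALocY i parS parB D P PB U = dirPadY PB (deltaALocY i parS parB D P U) := rfl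

/-- `G_□(U)` as A-0's local inverse of `Δ_{a,□}(U)`, definitional: `GAsqY … U = dirInvY PB (Δ_{a,□}(U))` (the shape `G_c := dirInvY (M_{χ_c}) (T_c)`).
[cite: Balaban1985BackgroundPropagators, pp.408–409 (G_□), (3.87) p.409, bookkeeping] -/
theorem GAsqY_apply (P : Module.End ℂ (BlkY i → 𝔸)) (PB : Module.End ℂ (FBondY i → 𝔸)) (U : CfgY 𝔸 i) :
    GAsqY i parS parB D P PB U = dirInvY PB (deltaALocY i parS parB D P U) := rfl

/-- `R_□ + P_□ = I`. [cite: Balaban1985BackgroundPropagators, (3.25) p.394, bookkeeping] -/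
theorem RlocY_add_PlocY (P : Module.End ℂ (BlkY i → 𝔸)) (U : CfgY 𝔸 i) :
    RlocY i parS D P U + PlocY i parS D P U = LinearMap.id := by
  rw [RlocY, sub_add_cancel]

/-- outside the unit locus `C_□(U) = 0`. [cite: Balaban1985BackgroundPropagators, pp.408–409 (C_□), bookkeeping] -/
theorem ClocY_of_not_isUnit {P : Module.End ℂ (BlkY i → 𝔸)} {U : CfgY 𝔸 i} (h : ¬ IsUnit (padXlocY i parS D P U)) :
    ClocY i parS D P U = 0 :=
  dirInvY_of_not_isUnit h

/-- … and then `P_□(U) = 0`, `R_□(U) = I`. [cite: Balaban1985BackgroundPropagators, pp.408–409 (C_□), bookkeeping] -/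
theorem RlocY_of_not_isUnit {P : Module.End ℂ (BlkY i → 𝔸)} {U : CfgY 𝔸 i} (h : ¬ IsUnit (padXlocY i parS D P U)) :
    RlocY i parS D P U = LinearMap.id := by
  rw [RlocY, PlocY, ClocY_of_not_isUnit i parS D h, LinearMap.zero_comp, LinearMap.comp_zero, LinearMap.comp_zero, sub_zero]

/-- outside the unit locus `G_□(U) = 0`. [cite: Balaban1985BackgroundPropagators, pp.408–409 (G_□), bookkeeping] -/
theorem GAsqY_of_not_isUnit {P : Module.End ℂ (BlkY i → 𝔸)} {PB : Module.End ℂ (FBondY i → 𝔸)} {U : CfgY 𝔸 i}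
    (h : ¬ IsUnit (padDeltaALocY i parS parB D P PB U)) : GAsqY i parS parB D P PB U = 0 :=
  dirInvY_of_not_isUnit h

/-- congruence: `C_□(U)` depends on `X_□` only through its compression `P X_□ P`. [cite: Balaban1985BackgroundPropagators, pp.408–409 (C_□), bookkeeping] -/
theorem ClocY_congr_of_compr {P : Module.End ℂ (BlkY i → 𝔸)} {U U' : CfgY 𝔸 i}
    (h : P * XY i parS (GsqY i parS D) U * P = P * XY i parS (GsqY i parS D) U' * P) : ClocY i parS D P U = ClocY i parS D P U' :=
  dirInvY_congr h

/-- congruence: `G_□(U)` depends on `Δ_{a,□}` only through its compression `PB Δ_{a,□} PB`. [cite: Balaban1985BackgroundPropagators, pp.408–409 (G_□), bookkeeping] -/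
theorem GAsqY_congr_of_compr {P : Module.End ℂ (BlkY i → 𝔸)} {PB : Module.End ℂ (FBondY i → 𝔸)} {U U' : CfgY 𝔸 i}
    (h : PB * deltaALocY i parS parB D P U * PB = PB * deltaALocY i parS parB D P U' * PB) :
    GAsqY i parS parB D P PB U = GAsqY i parS parB D P PB U' :=
  dirInvY_congr h

section BlockCut

variable {P : Module.End ℂ (BlkY i → 𝔸)} (hP : P * P = P)
include hP

/-- support on the left: `P C_□ = C_□`. [cite: Balaban1985BackgroundPropagators, pp.408–409 (C_□), bookkeeping] -/
theorem mul_ClocY (U : CfgY 𝔸 i) : P * ClocY i parS D P U = ClocY i parS D P U := mul_dirInvY hP _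

/-- support on the right: `C_□ P = C_□`. [cite: Balaban1985BackgroundPropagators, pp.408–409 (C_□), bookkeeping] -/
theorem ClocY_mul (U : CfgY 𝔸 i) : ClocY i parS D P U * P = ClocY i parS D P U := dirInvY_mul hP _

/-- the complement kills it: `(1 − P) C_□ = 0`. [cite: Balaban1985BackgroundPropagators, pp.408–409 (C_□), bookkeeping] -/
theorem compl_mul_ClocY (U : CfgY 𝔸 i) : (1 - P) * ClocY i parS D P U = 0 := compl_mul_dirInvY hP _

/-- `C_□ (1 − P) = 0`. [cite: Balaban1985BackgroundPropagators, pp.408–409 (C_□), bookkeeping] -/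
theorem ClocY_mul_compl (U : CfgY 𝔸 i) : ClocY i parS D P U * (1 - P) = 0 := dirInvY_mul_compl hP _

/-- ★ **`C_□(U)` IS THE INVERSE OF `Q′G′_□²Q′*(U)` ON THE CUBE's BLOCKS (right)**: `P X_□ P · C_□ = P` where the padded compression is a unit.
[cite: Balaban1985BackgroundPropagators, (3.87) p.409 (C_□ = (Q′G′_□²Q′*)⁻¹), pp.408–409] -/
theorem comprX_mul_ClocY {U : CfgY 𝔸 i} (hU : IsUnit (padXlocY i parS D P U)) :
    P * XY i parS (GsqY i parS D) U * P * ClocY i parS D P U = P :=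
  compr_mul_dirInvY hP hU

/-- ★ **(left)**: `C_□ · P X_□ P = P`. [cite: Balaban1985BackgroundPropagators, (3.87) p.409, pp.408–409] -/
theorem ClocY_mul_comprX {U : CfgY 𝔸 i} (hU : IsUnit (padXlocY i parS D P U)) :
    ClocY i parS D P U * (P * XY i parS (GsqY i parS D) U * P) = P :=
  dirInvY_mul_compr hP hU

/-- `P X_□ · C_□ = P`. [cite: Balaban1985BackgroundPropagators, (3.87) p.409, bookkeeping] -/
theorem P_mul_X_mul_ClocY {U : CfgY 𝔸 i} (hU : IsUnit (padXlocY i parS D P U)) :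
    P * XY i parS (GsqY i parS D) U * ClocY i parS D P U = P :=
  P_mul_T_mul_dirInvY hP hU

end BlockCut

section BondCut

variable (P : Module.End ℂ (BlkY i → 𝔸)) {PB : Module.End ℂ (FBondY i → 𝔸)} (hPB : PB * PB = PB)
include hPB

/-- support on the left: `PB G_□ = G_□`. [cite: Balaban1985BackgroundPropagators, pp.408–409 (G_□), bookkeeping] -/
theorem mul_GAsqY (U : CfgY 𝔸 i) : PB * GAsqY i parS parB D P PB U = GAsqY i parS parB D P PB U := mul_dirInvY hPB _

/-- support on the right: `G_□ PB = G_□`. [cite: Balaban1985BackgroundPropagators, pp.408–409 (G_□), bookkeeping] -/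
theorem GAsqY_mul (U : CfgY 𝔸 i) : GAsqY i parS parB D P PB U * PB = GAsqY i parS parB D P PB U := dirInvY_mul hPB _

/-- `(1 − PB) G_□ = 0`. [cite: Balaban1985BackgroundPropagators, pp.408–409 (G_□), bookkeeping] -/
theorem compl_mul_GAsqY (U : CfgY 𝔸 i) : (1 - PB) * GAsqY i parS parB D P PB U = 0 := compl_mul_dirInvY hPB _

/-- `G_□ (1 − PB) = 0`. [cite: Balaban1985BackgroundPropagators, pp.408–409 (G_□), bookkeeping] -/
theorem GAsqY_mul_compl (U : CfgY 𝔸 i) : GAsqY i parS parB D P PB U * (1 - PB) = 0 := dirInvY_mul_compl hPB _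

/-- ★ **`G_□(U)` IS THE INVERSE OF `Δ_{a,□}(U)` ON THE CUBE's BONDS (right)**: `PB Δ_{a,□} PB · G_□ = PB` where the padded compression is a unit.
[cite: Balaban1985BackgroundPropagators, pp.408–409 (G_□(U)), (3.27) p.395, Thm 3.3 p.399] -/
theorem compr_deltaALocY_mul_GAsqY {U : CfgY 𝔸 i} (hU : IsUnit (padDeltaALocY i parS parB D P PB U)) :
    PB * deltaALocY i parS parB D P U * PB * GAsqY i parS parB D P PB U = PB :=
  compr_mul_dirInvY hPB hU

/-- ★ **(left)**: `G_□ · PB Δ_{a,□} PB = PB`. [cite: Balaban1985BackgroundPropagators, pp.408–409 (G_□(U)), (3.27) p.395] -/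
theorem GAsqY_mul_compr_deltaALocY {U : CfgY 𝔸 i} (hU : IsUnit (padDeltaALocY i parS parB D P PB U)) :
    GAsqY i parS parB D P PB U * (PB * deltaALocY i parS parB D P U * PB) = PB :=
  dirInvY_mul_compr hPB hU

/-- `PB Δ_{a,□} · G_□ = PB`. [cite: Balaban1985BackgroundPropagators, pp.408–409 (G_□(U)), bookkeeping] -/
theorem PB_mul_deltaALocY_mul_GAsqY {U : CfgY 𝔸 i} (hU : IsUnit (padDeltaALocY i parS parB D P PB U)) :
    PB * deltaALocY i parS parB D P U * GAsqY i parS parB D P PB U = PB :=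
  P_mul_T_mul_dirInvY hPB hU

/-- ★★ **THE LOCAL-INVERSE PROPERTY `h Δ_{a,□}(U) G_□(U) h = h²`** for every real cut-off `h` absorbed by the bond cut (`M_h PB = M_h`, i.e. `h`
supported where `PB` acts as the identity) — the `h T_c G_c h = h²` input of the (3.105)-shaped local-family sum identities, from invertibility
of the padded compression alone. [cite: Balaban1985BackgroundPropagators, (3.87) p.409 (G₀ = Σ h_□G_□h_□), (3.105) p.414] -/
theorem cutMulY_deltaALocY_GAsqY_cutMulY {U : CfgY 𝔸 i} (hU : IsUnit (padDeltaALocY i parS parB D P PB U)) (h : FBondY i → ℝ)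
    (hh : cutMulY h * PB = cutMulY h) :
    cutMulY h * deltaALocY i parS parB D P U * GAsqY i parS parB D P PB U * cutMulY h = cutMulY h * cutMulY h := by
  rw [← hh, mul_assoc (cutMulY h) PB (deltaALocY i parS parB D P U),
    mul_assoc (cutMulY h) (PB * deltaALocY i parS parB D P U) (GAsqY i parS parB D P PB U), PB_mul_deltaALocY_mul_GAsqY i parS parB D P hPB hU,
    mul_assoc (cutMulY h) PB (cutMulY h * PB), ← mul_assoc PB (cutMulY h) PB, ← mul_assoc (cutMulY h) (PB * cutMulY h) PB,
    ← mul_assoc (cutMulY h) PB (cutMulY h), hh, mul_assoc (cutMulY h) (cutMulY h) PB, hh]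

end BondCut

/-! ## §3 The defect between the local and the global gauge projection — the `D(P − P_□)D*` term of (3.105) -/

/-- `R_□(U) − R(U)[G′] = P(U)[G′] − P_□(U)` for any site letter `G′` (with `P[G′] = G′Q′*(Q′G′²Q′*)⁻¹Q′G′`).
[cite: Balaban1985BackgroundPropagators, (3.105) p.414 (DPD* − DP_□D*), (3.25) p.394] -/
theorem RlocY_sub_RY (P : Module.End ℂ (BlkY i → 𝔸)) (Gp : SiteOpY 𝔸 i) (U : CfgY 𝔸 i) :
    RlocY i parS D P U - RY i parS Gp U =
      Gp U ∘ₗ QpsY i parS U ∘ₗ XinvY i parS Gp U ∘ₗ QpY i parS U ∘ₗ Gp U - PlocY i parS D P U := by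
  rw [RlocY, RY, sub_sub_sub_cancel_left]

/-- ★ **THE DEFECT IDENTITY**: `Δ_{a,□}(U) − Δ_a(U)[G′] = D_U (R_□(U) − R(U)[G′]) D*_U` — the two operators share the Laplace and averaging parts
and differ by the gauge term through the projections only. [cite: Balaban1985BackgroundPropagators, (3.105) p.414 (Σζ_□(DPD* − DP_□D*)h_□G_□h_□), (3.26) p.395] -/
theorem deltaALocY_sub_deltaAY (P : Module.End ℂ (BlkY i → 𝔸)) (Gp : SiteOpY 𝔸 i) (U : CfgY 𝔸 i) :
    deltaALocY i parS parB D P U - deltaAY i parS parB Gp U = gradY i U ∘ₗ (RlocY i parS D P U - RY i parS Gp U) ∘ₗ divY i U := by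
  rw [deltaALocY, deltaAY, LinearMap.sub_comp, LinearMap.comp_sub]
  abel

/-- the same, additively: `Δ_{a,□}(U) = Δ_a(U)[G′] + D_U (R_□ − R) D*_U` (the shape `T_c = T + (T_c − T)` of the local-family remainder).
[cite: Balaban1985BackgroundPropagators, (3.105) p.414, (3.26) p.395] -/
theorem deltaALocY_eq_deltaAY_add (P : Module.End ℂ (BlkY i → 𝔸)) (Gp : SiteOpY 𝔸 i) (U : CfgY 𝔸 i) :
    deltaALocY i parS parB D P U = deltaAY i parS parB Gp U + gradY i U ∘ₗ (RlocY i parS D P U - RY i parS Gp U) ∘ₗ divY i U := by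
  rw [← deltaALocY_sub_deltaAY, add_sub_cancel]

/-! ## §4 Sanity faces: the trivial block cut `P = 1` gives def-Y's global formulas at `G′ := G′_□`; `D = univ` gives `G′ := GpY` -/

/-- with `P = 1` the padded compression is `X_□(U)` itself. [cite: Balaban1985BackgroundPropagators, (3.25) p.394, bookkeeping] -/
theorem padXlocY_one (U : CfgY 𝔸 i) : padXlocY i parS D 1 U = XY i parS (GsqY i parS D) U := by
  rw [padXlocY, dirPadY, one_mul, mul_one, sub_self, add_zero]

/-- with `P = 1`: `C_□ = (Q′G′_□²Q′*)⁻¹ = XinvY[G′_□]`. [cite: Balaban1985BackgroundPropagators, (3.25) p.394, (3.87) p.409] -/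
theorem ClocY_one (U : CfgY 𝔸 i) : ClocY i parS D 1 U = XinvY i parS (GsqY i parS D) U := by
  rw [ClocY, dirInvY_one_left]
  rfl

/-- with `P = 1`: `R_□ = R[G′_□]` — def-Y's (3.25) at the local site inverse. [cite: Balaban1985BackgroundPropagators, (3.25) p.394] -/
theorem RlocY_one (U : CfgY 𝔸 i) : RlocY i parS D 1 U = RY i parS (GsqY i parS D) U := by
  rw [RlocY, PlocY, ClocY_one]
  rfl

/-- ★ with `P = 1`: `Δ_{a,□}(U) = Δ_a(U)[G′_□]` — def-Y's (3.26) at the local site inverse. [cite: Balaban1985BackgroundPropagators, (3.26) p.395, (3.105) p.414] -/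
theorem deltaALocY_one (U : CfgY 𝔸 i) : deltaALocY i parS parB D 1 U = deltaAY i parS parB (GsqY i parS D) U := by
  rw [deltaALocY, RlocY_one]
  rfl

/-- with `P = 1`, `PB = 1`: `G_□ = Δ_a[G′_□]⁻¹ = GAY[G′_□]`. [cite: Balaban1985BackgroundPropagators, (3.27) p.395, pp.408–409] -/
theorem GAsqY_one_one : GAsqY i parS parB D 1 1 = GAY i parS parB (GsqY i parS D) := by
  funext U
  rw [GAsqY, dirInvY_one_left, deltaALocY_one]
  rfl

/-- ★ **THE WHOLE-LATTICE FACE**: `D = univ`, `P = 1` give the global `Δ_a(U)` of (3.26) at def-Y's genuine site inverse `G′ = GpY`.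
[cite: Balaban1985BackgroundPropagators, (3.26) p.395, (3.25) p.394] -/
theorem deltaALocY_univ_one (U : CfgY 𝔸 i) : deltaALocY i parS parB Finset.univ 1 U = deltaAY i parS parB (GpY i parS) U := by
  rw [deltaALocY_one, GsqY_univ]

/-- … and `G_□ = G(U) = Δ_a(U)⁻¹` of (3.27). [cite: Balaban1985BackgroundPropagators, (3.27) p.395] -/
theorem GAsqY_univ_one_one : GAsqY i parS parB Finset.univ 1 1 = GAY i parS parB (GpY i parS) := by
  rw [GAsqY_one_one, GsqY_univ]

end Letters

end Literature.MathematicalPhysics.QuantumFieldTheory.Balaban1983to89.Node00.OpsYDeltaALocal
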